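import Mathlib
import HarnessLib
import Literature.RepresentationTheory.CompactGroups.UnitaryTrick
import Literature.MathematicalPhysics.QuantumFieldTheory.Sweep1
import Literature.MathematicalPhysics.QuantumFieldTheory.Sweep1AreaLawProofs
import Summits.QuantumFields.YangMills.Theorems.PencilRigidityCurvatureKernelBoundSwapReflectionPositivityAction

/-!
# `CurvatureKernelBound` — stub `SwapReflectionPositivity` (F2), part 3/4: cone data, finite product

Support file for crux `stmt-QuantumFields-11687`, line `coupling-trichotomy`, stub
`SwapReflectionPositivity` (diagonal-mirror reflection positivity of the free-boundary Wilson measure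
on `{-L,…,L}⁴`; FILS 1978 Thm. 2.1, Osterwalder–Seiler 1978 §2). This part: the symmetric finite set
of links `E` (links of the box, `B`, `θB`) carrying the integrand; dependence on positive links,
bounds and measurability of the cone data `g = F e^{βA + βS_M/2}`, `aᵢ = √(β/2) σ(V₊)_{ab}` (and
conjugates); reduction of `dg_∞`-integrals of functions of the links in `E` to the product Haar
measure on `G^E` (`integral_restrict_infinitePi`), and the coordinate permutation of `G^E` induced
by the swap (measure preserving, intertwining `Θ` with the extension by `1` off `E`). Helpers in the
sub-namespace `SwapRP`. [folklore]
-/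

noncomputable section

open MeasureTheory
open scoped ComplexConjugate ComplexOrder
open Literature.MathematicalPhysics.QuantumFieldTheory Literature.Probability.LatticeModels

namespace Summit.QuantumFields.YangMills.Theorems.CurvatureKernel

namespace SwapRP

/-! ## The finite symmetric set of links carrying the integrand -/

section EdgeSet

variable {i j : Fin 4}

/-- The links of the box (both endpoints in the box) together with `B ∪ θB` form a
reflection-symmetric finite set of links. [folklore] -/
theorem reflEdge_mem_edgeSet (i j : Fin 4) {L : ℕ} {B : Finset (Site 4 × Fin 4)} {e : Site 4 × Fin
    4}
    (he : e ∈ ((box 4 L ×ˢ (Finset.univ : Finset (Fin 4))).filter (fun e : Site 4 × Fin 4 => e.1 +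
        Pi.single e.2 1 ∈ box 4 L)) ∪ (B ∪ B.image (fun e : Site 4 × Fin 4 => (e.1 ∘ Equiv.swap i j,
        Equiv.swap i j e.2)))) :
    (e.1 ∘ Equiv.swap i j, Equiv.swap i j e.2) ∈ ((box 4 L ×ˢ (Finset.univ : Finset (Fin 4))).filter
        (fun e : Site 4 × Fin 4 => e.1 + Pi.single e.2 1 ∈ box 4 L)) ∪ (B ∪ B.image (fun e : Site 4
        × Fin 4 => (e.1 ∘ Equiv.swap i j, Equiv.swap i j e.2))) := by
  simp only [Finset.mem_union, Finset.mem_filter, Finset.mem_product, Finset.mem_univ, and_true,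
    Finset.mem_image] at he ⊢
  rcases he with ⟨h1, h2⟩ | hB | ⟨b, hb, rfl⟩
  · refine Or.inl ⟨comp_swap_mem_box h1 i j, ?_⟩
    rw [← add_single_comp_swap]
    exact comp_swap_mem_box h2 i j
  · exact Or.inr (Or.inr ⟨e, hB, rfl⟩)
  · refine Or.inr (Or.inl ?_)
    rw [reflEdge_reflEdge]
    exact hb

/-- The four links of a plaquette of the box are links of the box. [folklore] -/
theorem plaqEdges_mem_boxEdges {L : ℕ} {p : Site 4 × Fin 4 × Fin 4} (hp : p ∈ plaquettesIn (box 4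
    L)) :
    (p.1, p.2.1) ∈ ((box 4 L ×ˢ (Finset.univ : Finset (Fin 4))).filter (fun e : Site 4 × Fin 4 =>
        e.1 + Pi.single e.2 1 ∈ box 4 L)) ∧ (p.1 + Pi.single p.2.1 1, p.2.2) ∈ ((box 4 L ×ˢ
        (Finset.univ : Finset (Fin 4))).filter (fun e : Site 4 × Fin 4 => e.1 + Pi.single e.2 1 ∈
        box 4 L)) ∧
      (p.1 + Pi.single p.2.2 1, p.2.1) ∈ ((box 4 L ×ˢ (Finset.univ : Finset (Fin 4))).filter (fun e
          : Site 4 × Fin 4 => e.1 + Pi.single e.2 1 ∈ box 4 L)) ∧ (p.1, p.2.2) ∈ ((box 4 L ×ˢ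
          (Finset.univ : Finset (Fin 4))).filter (fun e : Site 4 × Fin 4 => e.1 + Pi.single e.2 1 ∈
          box 4 L)) := by
  rw [mem_plaquettesIn_iff] at hp
  obtain ⟨hx, -, hk, hl, hkl⟩ := hp
  simp only [Finset.mem_filter, Finset.mem_product, Finset.mem_univ, and_true]
  refine ⟨⟨hx, hk⟩, ⟨hk, hkl⟩, ⟨hl, ?_⟩, ⟨hx, hl⟩⟩
  rwa [add_right_comm]

end EdgeSet

/-! ## Dependence on links, bounds and measurability of the cone data `g`, `aᵢ` -/

section ConeData

variable {G : Type*} [Group G] [TopologicalSpace G] [IsTopologicalGroup G] [CompactSpace G]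
variable {N : ℕ} (ρ : G →* Matrix (Fin N) (Fin N) ℂ) {i j : Fin 4}

omit [TopologicalSpace G] [IsTopologicalGroup G] [CompactSpace G] in
/-- The positive part of the action depends only on positive links. [folklore] -/
theorem dependsOn_apos (L : ℕ) :
    DependsOn (fun V : ZdGaugeConfig 4 G => (∑ p ∈ (plaquettesIn (box 4 L)).filter (fun p : Site 4 ×
        Fin 4 × Fin 4 => ((p.1 j ≤ p.1 i ∧ (p.1 + Pi.single p.2.1 1 : Site 4) j ≤ (p.1 + Pi.single
        p.2.1 1 : Site 4) i ∧ (p.1 + Pi.single p.2.2 1 : Site 4) j ≤ (p.1 + Pi.single p.2.2 1 : Site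
        4) i ∧ (p.1 + Pi.single p.2.1 1 + Pi.single p.2.2 1 : Site 4) j ≤ (p.1 + Pi.single p.2.1 1 +
        Pi.single p.2.2 1 : Site 4) i) ∧ ¬ (p.1 i = p.1 j ∧ (p.1 + Pi.single p.2.1 1 : Site 4) i =
        (p.1 + Pi.single p.2.1 1 : Site 4) j ∧ (p.1 + Pi.single p.2.2 1 : Site 4) i = (p.1 +
        Pi.single p.2.2 1 : Site 4) j))), (ρ (ZdGaugeConfig.plaquette V p.1 p.2.1 p.2.2)).trace.re))
        {e : Site 4 × Fin 4 | (e.1 j ≤ e.1 i ∧ (e.1 + Pi.single e.2 (1 : ℤ) : Site 4) j ≤ (e.1 +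
        Pi.single e.2 (1 : ℤ) : Site 4) i)} := by
  intro U V hUV
  refine Finset.sum_congr rfl fun p hp => ?_
  obtain ⟨h1, h2, h3, h4⟩ := posE_of_pos (Finset.mem_filter.1 hp).2
  simp only [ZdGaugeConfig.plaquette, hUV (p.1, p.2.1) h1, hUV (p.1 + Pi.single p.2.1 1, p.2.2) h2,
    hUV (p.1 + Pi.single p.2.2 1, p.2.1) h3, hUV (p.1, p.2.2) h4]

omit [TopologicalSpace G] [IsTopologicalGroup G] [CompactSpace G] in
/-- The mirror part of the action depends only on mirror links. [folklore] -/
theorem dependsOn_smir (L : ℕ) :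
    DependsOn (fun V : ZdGaugeConfig 4 G => (∑ p ∈ (plaquettesIn (box 4 L)).filter (fun p : Site 4 ×
        Fin 4 × Fin 4 => (p.1 i = p.1 j ∧ (p.1 + Pi.single p.2.1 1 : Site 4) i = (p.1 + Pi.single
        p.2.1 1 : Site 4) j ∧ (p.1 + Pi.single p.2.2 1 : Site 4) i = (p.1 + Pi.single p.2.2 1 : Site
        4) j)), (ρ (ZdGaugeConfig.plaquette V p.1 p.2.1 p.2.2)).trace.re)) {e : Site 4 × Fin 4 |
        (e.1 i = e.1 j ∧ (e.1 + Pi.single e.2 (1 : ℤ) : Site 4) i = (e.1 + Pi.single e.2 (1 : ℤ) :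
        Site 4) j)} := by
  intro U V hUV
  refine Finset.sum_congr rfl fun p hp => ?_
  obtain ⟨h1, h2, h3, h4⟩ := mirE_of_mir (Finset.mem_filter.1 hp).2
  simp only [ZdGaugeConfig.plaquette, hUV (p.1, p.2.1) h1, hUV (p.1 + Pi.single p.2.1 1, p.2.2) h2,
    hUV (p.1 + Pi.single p.2.2 1, p.2.1) h3, hUV (p.1, p.2.2) h4]

omit [TopologicalSpace G] [IsTopologicalGroup G] [CompactSpace G] in
/-- The Wilson action of the box depends only on the links of the box. [folklore] -/
theorem dependsOn_zdWilsonAction_box (L : ℕ) :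
    DependsOn (zdWilsonAction ρ (box 4 L) : ZdGaugeConfig 4 G → ℝ) (((box 4 L ×ˢ (Finset.univ :
        Finset (Fin 4))).filter (fun e : Site 4 × Fin 4 => e.1 + Pi.single e.2 1 ∈ box 4 L)) : Set
        (Site 4 × Fin 4)) := by
  intro U V hUV
  unfold zdWilsonAction
  refine Finset.sum_congr rfl fun p hp => ?_
  obtain ⟨h1, h2, h3, h4⟩ := plaqEdges_mem_boxEdges hp
  simp only [ZdGaugeConfig.plaquette, hUV _ (Finset.mem_coe.2 h1), hUV _ (Finset.mem_coe.2 h2),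
    hUV _ (Finset.mem_coe.2 h3), hUV _ (Finset.mem_coe.2 h4)]

omit [TopologicalSpace G] [IsTopologicalGroup G] [CompactSpace G] in
/-- The observable `g = F e^{βA + βS_M/2}` depends only on positive links. [folklore] -/
theorem dependsOn_gobs (β : ℝ) (L : ℕ) {F : ZdGaugeConfig 4 G → ℝ} {B : Finset (Site 4 × Fin 4)}
    (hFdep : DependsOn F (B : Set (Site 4 × Fin 4))) (hB : ∀ e ∈ B, (e.1 j ≤ e.1 i ∧ (e.1 +
        Pi.single e.2 (1 : ℤ) : Site 4) j ≤ (e.1 + Pi.single e.2 (1 : ℤ) : Site 4) i)) :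
    DependsOn (fun V : ZdGaugeConfig 4 G => ((F V : ℂ) * (Real.exp (β * (∑ p ∈ (plaquettesIn (box 4
        L)).filter (fun p : Site 4 × Fin 4 × Fin 4 => ((p.1 j ≤ p.1 i ∧ (p.1 + Pi.single p.2.1 1 :
        Site 4) j ≤ (p.1 + Pi.single p.2.1 1 : Site 4) i ∧ (p.1 + Pi.single p.2.2 1 : Site 4) j ≤
        (p.1 + Pi.single p.2.2 1 : Site 4) i ∧ (p.1 + Pi.single p.2.1 1 + Pi.single p.2.2 1 : Site
        4) j ≤ (p.1 + Pi.single p.2.1 1 + Pi.single p.2.2 1 : Site 4) i) ∧ ¬ (p.1 i = p.1 j ∧ (p.1 +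
        Pi.single p.2.1 1 : Site 4) i = (p.1 + Pi.single p.2.1 1 : Site 4) j ∧ (p.1 + Pi.single
        p.2.2 1 : Site 4) i = (p.1 + Pi.single p.2.2 1 : Site 4) j))), (ρ (ZdGaugeConfig.plaquette V
        p.1 p.2.1 p.2.2)).trace.re) + β / 2 * (∑ p ∈ (plaquettesIn (box 4 L)).filter (fun p : Site 4
        × Fin 4 × Fin 4 => (p.1 i = p.1 j ∧ (p.1 + Pi.single p.2.1 1 : Site 4) i = (p.1 + Pi.single
        p.2.1 1 : Site 4) j ∧ (p.1 + Pi.single p.2.2 1 : Site 4) i = (p.1 + Pi.single p.2.2 1 : Site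
        4) j)), (ρ (ZdGaugeConfig.plaquette V p.1 p.2.1 p.2.2)).trace.re)) : ℂ))) {e : Site 4 × Fin
        4 | (e.1 j ≤ e.1 i ∧ (e.1 + Pi.single e.2 (1 : ℤ) : Site 4) j ≤ (e.1 + Pi.single e.2 (1 : ℤ)
        : Site 4) i)} := by
  intro U V hUV
  have hF : F U = F V := hFdep fun e he => hUV e (hB e (Finset.mem_coe.1 he))
  have hA := dependsOn_apos ρ L hUV
  have hS := dependsOn_smir ρ L fun e he => hUV e (posE_of_mirE he)
  dsimp only at hA hS
  simp only [hF, hA, hS]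

/-- The coefficient functions `aᵢ` depend only on positive links. [folklore] -/
theorem dependsOn_acoef (hij : i ≠ j) (hρ : Continuous ρ) (β : ℝ) (L : ℕ) (idx : (↥((plaquettesIn
    (box 4 L)).filter (fun p : Site 4 × Fin 4 × Fin 4 => (p.2.1 = i ∧ p.2.2 = j ∧ p.1 i = p.1 j))) ×
    Fin N × Fin N × Bool)) :
    DependsOn (fun V : ZdGaugeConfig 4 G => ((Real.sqrt (β / 2) : ℂ) * (if idx.2.2.2 then
        Literature.RepresentationTheory.CompactGroups.CompactGroup.unitarize ρ hρ (V (idx.1.1.1, i)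
        * V (idx.1.1.1 + Pi.single i 1, j)) idx.2.1 idx.2.2.1 else conj
        (Literature.RepresentationTheory.CompactGroups.CompactGroup.unitarize ρ hρ (V (idx.1.1.1, i)
        * V (idx.1.1.1 + Pi.single i 1, j)) idx.2.1 idx.2.2.1)))) {e : Site 4 × Fin 4 | (e.1 j ≤ e.1
        i ∧ (e.1 + Pi.single e.2 (1 : ℤ) : Site 4) j ≤ (e.1 + Pi.single e.2 (1 : ℤ) : Site 4) i)} :=
        by
  intro U V hUV
  obtain ⟨h1, h2⟩ := posE_of_cut hij (Finset.mem_filter.1 idx.1.2).2.2.2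
  simp only [hUV (idx.1.1.1, i) h1, hUV (idx.1.1.1 + Pi.single i 1, j) h2]

/-- A partial sum of `Re tr ρ(U_p)` over plaquettes of the box is bounded by `N · #Λ'`
(`|Re tr ρ(g)| ≤ N` for a continuous representation of a compact group). [folklore] -/
theorem abs_sum_filter_plaqRe_le (hρ : Continuous ρ) (L : ℕ) (P : Site 4 × Fin 4 × Fin 4 → Prop)
    [DecidablePred P] (V : ZdGaugeConfig 4 G) :
    |∑ p ∈ (plaquettesIn (box 4 L)).filter P, (ρ (ZdGaugeConfig.plaquette V p.1 p.2.1
        p.2.2)).trace.re| ≤ (N : ℝ) * (plaquettesIn (box 4 L)).card := by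
  calc |∑ p ∈ (plaquettesIn (box 4 L)).filter P, (ρ (ZdGaugeConfig.plaquette V p.1 p.2.1
      p.2.2)).trace.re|
      ≤ ∑ p ∈ (plaquettesIn (box 4 L)).filter P, |(ρ (ZdGaugeConfig.plaquette V p.1 p.2.1
          p.2.2)).trace.re| := Finset.abs_sum_le_sum_abs _ _
    _ ≤ ∑ _p ∈ (plaquettesIn (box 4 L)).filter P, (N : ℝ) := Finset.sum_le_sum fun p _ => by
        simpa only [Fintype.card_fin] using
          Literature.RepresentationTheory.CompactGroups.CompactGroup.abs_re_trace_le_card ρ hρ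
            (ZdGaugeConfig.plaquette V p.1 p.2.1 p.2.2)
    _ ≤ ∑ _p ∈ plaquettesIn (box 4 L), (N : ℝ) :=
        Finset.sum_le_sum_of_subset_of_nonneg (Finset.filter_subset _ _) fun _ _ _ =>
            Nat.cast_nonneg _
    _ = (N : ℝ) * (plaquettesIn (box 4 L)).card := by
        rw [Finset.sum_const, nsmul_eq_mul, mul_comm]

omit [TopologicalSpace G] [IsTopologicalGroup G] [CompactSpace G] in
/-- The exponent bound behind `‖g‖ ≤ |C| e^{(|β| + |β/2|) N #Λ'}`. [folklore] -/
theorem exp_le_exp_of_abs_le {β A S K : ℝ} (hA : |A| ≤ K) (hS : |S| ≤ K) :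
    Real.exp (β * A + β / 2 * S) ≤ Real.exp ((|β| + |β / 2|) * K) := by
  refine Real.exp_le_exp.2 ?_
  rw [add_mul]
  refine add_le_add ?_ ?_
  · calc β * A ≤ |β * A| := le_abs_self _
      _ = |β| * |A| := abs_mul _ _
      _ ≤ |β| * K := mul_le_mul_of_nonneg_left hA (abs_nonneg _)
  · calc β / 2 * S ≤ |β / 2 * S| := le_abs_self _
      _ = |β / 2| * |S| := abs_mul _ _
      _ ≤ |β / 2| * K := mul_le_mul_of_nonneg_left hS (abs_nonneg _)

/-- `g` is bounded. [folklore] -/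
theorem norm_gobs_le (hρ : Continuous ρ) (β : ℝ) (L : ℕ) {F : ZdGaugeConfig 4 G → ℝ} {C : ℝ}
    (hC : ∀ U, |F U| ≤ C) (V : ZdGaugeConfig 4 G) :
    ‖((F V : ℂ) * (Real.exp (β * (∑ p ∈ (plaquettesIn (box 4 L)).filter (fun p : Site 4 × Fin 4 ×
        Fin 4 => ((p.1 j ≤ p.1 i ∧ (p.1 + Pi.single p.2.1 1 : Site 4) j ≤ (p.1 + Pi.single p.2.1 1 :
        Site 4) i ∧ (p.1 + Pi.single p.2.2 1 : Site 4) j ≤ (p.1 + Pi.single p.2.2 1 : Site 4) i ∧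
        (p.1 + Pi.single p.2.1 1 + Pi.single p.2.2 1 : Site 4) j ≤ (p.1 + Pi.single p.2.1 1 +
        Pi.single p.2.2 1 : Site 4) i) ∧ ¬ (p.1 i = p.1 j ∧ (p.1 + Pi.single p.2.1 1 : Site 4) i =
        (p.1 + Pi.single p.2.1 1 : Site 4) j ∧ (p.1 + Pi.single p.2.2 1 : Site 4) i = (p.1 +
        Pi.single p.2.2 1 : Site 4) j))), (ρ (ZdGaugeConfig.plaquette V p.1 p.2.1 p.2.2)).trace.re)
        + β / 2 * (∑ p ∈ (plaquettesIn (box 4 L)).filter (fun p : Site 4 × Fin 4 × Fin 4 => (p.1 i =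
        p.1 j ∧ (p.1 + Pi.single p.2.1 1 : Site 4) i = (p.1 + Pi.single p.2.1 1 : Site 4) j ∧ (p.1 +
        Pi.single p.2.2 1 : Site 4) i = (p.1 + Pi.single p.2.2 1 : Site 4) j)), (ρ
        (ZdGaugeConfig.plaquette V p.1 p.2.1 p.2.2)).trace.re)) : ℂ))‖ ≤ |C| * Real.exp ((|β| + |β /
        2|) * ((N : ℝ) * (plaquettesIn (box 4 L)).card)) := by
  rw [norm_mul, Complex.norm_real, Complex.norm_real, Real.norm_eq_abs, Real.norm_eq_abs,
    abs_of_pos (Real.exp_pos _)]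
  exact mul_le_mul ((hC V).trans (le_abs_self _))
    (exp_le_exp_of_abs_le (abs_sum_filter_plaqRe_le ρ hρ L _ V) (abs_sum_filter_plaqRe_le ρ hρ L _
        V))
    (Real.exp_pos _).le (abs_nonneg _)

/-- The coefficient functions are bounded by `√(β/2)` (unitary matrix entries have norm `≤ 1`).
[folklore] -/
theorem norm_acoef_le (hρ : Continuous ρ) (β : ℝ) (L : ℕ) (idx : (↥((plaquettesIn (box 4 L)).filter
    (fun p : Site 4 × Fin 4 × Fin 4 => (p.2.1 = i ∧ p.2.2 = j ∧ p.1 i = p.1 j))) × Fin N × Fin N ×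
    Bool)) (V : ZdGaugeConfig 4 G) :
    ‖((Real.sqrt (β / 2) : ℂ) * (if idx.2.2.2 then
        Literature.RepresentationTheory.CompactGroups.CompactGroup.unitarize ρ hρ (V (idx.1.1.1, i)
        * V (idx.1.1.1 + Pi.single i 1, j)) idx.2.1 idx.2.2.1 else conj
        (Literature.RepresentationTheory.CompactGroups.CompactGroup.unitarize ρ hρ (V (idx.1.1.1, i)
        * V (idx.1.1.1 + Pi.single i 1, j)) idx.2.1 idx.2.2.1)))‖ ≤ Real.sqrt (β / 2) := by
  rw [norm_mul, Complex.norm_real, Real.norm_eq_abs, abs_of_nonneg (Real.sqrt_nonneg _)]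
  refine mul_le_of_le_one_right (Real.sqrt_nonneg _) ?_
  split_ifs
  · exact Literature.RepresentationTheory.CompactGroups.CompactGroup.norm_unitarize_apply_le_one ρ
      hρ _ _ _
  · rw [Complex.norm_conj]
    exact Literature.RepresentationTheory.CompactGroups.CompactGroup.norm_unitarize_apply_le_one ρ
        hρ _ _ _

variable [MeasurableSpace G] [BorelSpace G] [SecondCountableTopology G]

omit [CompactSpace G] in
/-- `U ↦ Re tr ρ(U_p)` is measurable. [folklore] -/
theorem measurable_plaqRe (hρ : Continuous ρ) (p : Site 4 × Fin 4 × Fin 4) :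
    Measurable (fun V : ZdGaugeConfig 4 G => (ρ (ZdGaugeConfig.plaquette V p.1 p.2.1
        p.2.2)).trace.re) :=
  (Complex.continuous_re.comp
    (hρ.comp (AreaLaw.continuous_plaquette p.1 p.2.1 p.2.2)).matrix_trace).measurable

omit [CompactSpace G] in
/-- `g` is measurable. [folklore] -/
theorem measurable_gobs (hρ : Continuous ρ) (β : ℝ) (L : ℕ) {F : ZdGaugeConfig 4 G → ℝ}
    (hFm : Measurable F) : Measurable (fun V : ZdGaugeConfig 4 G => ((F V : ℂ) * (Real.exp (β * (∑ p
        ∈ (plaquettesIn (box 4 L)).filter (fun p : Site 4 × Fin 4 × Fin 4 => ((p.1 j ≤ p.1 i ∧ (p.1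
        + Pi.single p.2.1 1 : Site 4) j ≤ (p.1 + Pi.single p.2.1 1 : Site 4) i ∧ (p.1 + Pi.single
        p.2.2 1 : Site 4) j ≤ (p.1 + Pi.single p.2.2 1 : Site 4) i ∧ (p.1 + Pi.single p.2.1 1 +
        Pi.single p.2.2 1 : Site 4) j ≤ (p.1 + Pi.single p.2.1 1 + Pi.single p.2.2 1 : Site 4) i) ∧
        ¬ (p.1 i = p.1 j ∧ (p.1 + Pi.single p.2.1 1 : Site 4) i = (p.1 + Pi.single p.2.1 1 : Site 4)
        j ∧ (p.1 + Pi.single p.2.2 1 : Site 4) i = (p.1 + Pi.single p.2.2 1 : Site 4) j))), (ρ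
        (ZdGaugeConfig.plaquette V p.1 p.2.1 p.2.2)).trace.re) + β / 2 * (∑ p ∈ (plaquettesIn (box 4
        L)).filter (fun p : Site 4 × Fin 4 × Fin 4 => (p.1 i = p.1 j ∧ (p.1 + Pi.single p.2.1 1 :
        Site 4) i = (p.1 + Pi.single p.2.1 1 : Site 4) j ∧ (p.1 + Pi.single p.2.2 1 : Site 4) i =
        (p.1 + Pi.single p.2.2 1 : Site 4) j)), (ρ (ZdGaugeConfig.plaquette V p.1 p.2.1
        p.2.2)).trace.re)) : ℂ))) :=
  (Complex.measurable_ofReal.comp hFm).mul (Complex.measurable_ofReal.comp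
    (((Finset.measurable_sum _ fun p _ => measurable_plaqRe ρ hρ p).const_mul β).add
      ((Finset.measurable_sum _ fun p _ => measurable_plaqRe ρ hρ p).const_mul (β / 2))).exp)

/-- The coefficient functions are measurable. [folklore] -/
theorem measurable_acoef (hρ : Continuous ρ) (β : ℝ) (L : ℕ) (idx : (↥((plaquettesIn (box 4
    L)).filter (fun p : Site 4 × Fin 4 × Fin 4 => (p.2.1 = i ∧ p.2.2 = j ∧ p.1 i = p.1 j))) × Fin N
    × Fin N × Bool)) :
    Measurable (fun V : ZdGaugeConfig 4 G => ((Real.sqrt (β / 2) : ℂ) * (if idx.2.2.2 then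
        Literature.RepresentationTheory.CompactGroups.CompactGroup.unitarize ρ hρ (V (idx.1.1.1, i)
        * V (idx.1.1.1 + Pi.single i 1, j)) idx.2.1 idx.2.2.1 else conj
        (Literature.RepresentationTheory.CompactGroups.CompactGroup.unitarize ρ hρ (V (idx.1.1.1, i)
        * V (idx.1.1.1 + Pi.single i 1, j)) idx.2.1 idx.2.2.1)))) := by
  have hc : Continuous fun V : ZdGaugeConfig 4 G =>
      Literature.RepresentationTheory.CompactGroups.CompactGroup.unitarize ρ hρ (V (idx.1.1.1, i) *
      V (idx.1.1.1 + Pi.single i 1, j)) :=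
    (Literature.RepresentationTheory.CompactGroups.CompactGroup.continuous_unitarize ρ hρ).comp
      ((continuous_apply _).mul (continuous_apply _))
  have hm : Measurable fun V : ZdGaugeConfig 4 G =>
      Literature.RepresentationTheory.CompactGroups.CompactGroup.unitarize ρ hρ (V (idx.1.1.1, i) *
      V (idx.1.1.1 + Pi.single i 1, j)) idx.2.1 idx.2.2.1 :=
    (hc.matrix_elem idx.2.1 idx.2.2.1).measurable
  by_cases hb : idx.2.2.2 = true
  · simp only [hb, ↓reduceIte]
    exact hm.const_mul _
  · simp only [hb, Bool.false_eq_true, ↓reduceIte]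
    exact (Complex.continuous_conj.measurable.comp hm).const_mul _

end ConeData

/-! ## From the infinite product `dg_∞` to the finite product over a symmetric set of links -/

section Transfer

variable {G : Type*} [Group G] [TopologicalSpace G] [IsTopologicalGroup G] [CompactSpace G]
  [MeasurableSpace G] [BorelSpace G] {i j : Fin 4}

omit [TopologicalSpace G] [IsTopologicalGroup G] [CompactSpace G] [BorelSpace G] in
/-- Extension by the identity off a finite set of links is measurable. [folklore] -/
theorem measurable_extCfg (E : Finset (Site 4 × Fin 4)) : Measurable (fun v : ↥E → G => (fun e :
    Site 4 × Fin 4 => if h : e ∈ E then v ⟨e, h⟩ else (1 : G))) := by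
  refine measurable_pi_lambda _ fun e => ?_
  by_cases h : e ∈ E
  · simp only [h, dif_pos]
    exact measurable_pi_apply _
  · simp only [h, dif_neg, not_false_eq_true]
    exact measurable_const

omit [TopologicalSpace G] [IsTopologicalGroup G] [CompactSpace G] [MeasurableSpace G] [BorelSpace G]
    in
/-- A function of the links in `E` does not see the links off `E`. [folklore] -/
theorem apply_ext_restrict {α : Type*} {E : Finset (Site 4 × Fin 4)} {H : ZdGaugeConfig 4 G → α}
    (hdep : DependsOn H (E : Set (Site 4 × Fin 4))) (U : ZdGaugeConfig 4 G) :
    H ((fun e : Site 4 × Fin 4 => if h : e ∈ E then (E.restrict U) ⟨e, h⟩ else (1 : G))) = H U := by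
  apply hdep
  intro e he
  rw [Finset.mem_coe] at he
  show (if h : e ∈ E then E.restrict U ⟨e, h⟩ else (1 : G)) = U e
  rw [dif_pos he]
  rfl

/-- **`ℤ⁴`-integrals of functions of finitely many links are integrals over the finite product
Haar measure** (Mathlib's `integral_restrict_infinitePi`). [folklore] -/
theorem integral_zdHaar_eq_integral_pi {E : Finset (Site 4 × Fin 4)} (H : ZdGaugeConfig 4 G → ℂ)
    (hHm : Measurable H) (hdep : DependsOn H (E : Set (Site 4 × Fin 4))) :
    ∫ U, H U ∂zdHaar 4 G = ∫ v, H ((fun e : Site 4 × Fin 4 => if h : e ∈ E then v ⟨e, h⟩ else (1 :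
        G))) ∂Measure.pi (fun _ : ↥E => haarProbability G) := by
  calc ∫ U, H U ∂zdHaar 4 G
      = ∫ U, (fun v : ↥E → G => H ((fun e : Site 4 × Fin 4 => if h : e ∈ E then v ⟨e, h⟩ else (1 :
          G)))) (E.restrict U)
          ∂Measure.infinitePi (fun _ : Site 4 × Fin 4 => haarProbability G) :=
        integral_congr_ae (ae_of_all _ fun U => (apply_ext_restrict hdep U).symm)
    _ = _ := integral_restrict_infinitePi (μ := fun _ : Site 4 × Fin 4 => haarProbability G)
          ((hHm.comp (measurable_extCfg E)).aestronglyMeasurable)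

omit [TopologicalSpace G] [IsTopologicalGroup G] [CompactSpace G] [MeasurableSpace G] [BorelSpace G]
    in
/-- On a reflection-symmetric set of links, reflecting the extended configuration is extending the
permuted coordinates. [folklore] -/
theorem swapCfg_ext {E : Finset (Site 4 × Fin 4)} (hE : ∀ e ∈ E, (e.1 ∘ Equiv.swap i j, Equiv.swap i
    j e.2) ∈ E) (v : ↥E → G) :
    (fun e : Site 4 × Fin 4 => ((fun e : Site 4 × Fin 4 => if h : e ∈ E then v ⟨e, h⟩ else (1 : G)))
        (e.1 ∘ Equiv.swap i j, Equiv.swap i j e.2)) = (fun e : Site 4 × Fin 4 => if h : e ∈ E then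
        ((fun e : ↥E => v ⟨((e.1).1 ∘ Equiv.swap i j, Equiv.swap i j (e.1).2), hE e.1 e.2⟩)) ⟨e, h⟩
        else (1 : G)) := by
  funext e
  dsimp only
  by_cases h : e ∈ E
  · rw [dif_pos h, dif_pos (hE e h)]
  · have h' : (e.1 ∘ Equiv.swap i j, Equiv.swap i j e.2) ∉ E := by
      intro h'
      exact h (by simpa only [reflEdge_reflEdge] using hE _ h')
    rw [dif_neg h, dif_neg h']

/-- **The coordinate permutation induced by the reflection preserves the finite product Haar
measure** (relabelling by an involution, `measurePreserving_arrowCongr'`). [folklore] -/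
theorem measurePreserving_swapIdx {E : Finset (Site 4 × Fin 4)} (hE : ∀ e ∈ E, (e.1 ∘ Equiv.swap i
    j, Equiv.swap i j e.2) ∈ E) :
    MeasurePreserving (fun v : ↥E → G => (fun e : ↥E => v ⟨((e.1).1 ∘ Equiv.swap i j, Equiv.swap i j
        (e.1).2), hE e.1 e.2⟩))
      (Measure.pi fun _ : ↥E => haarProbability G) (Measure.pi fun _ : ↥E => haarProbability G) :=
          by
  set π : Equiv.Perm ↥E := Function.Involutive.toPerm
    (fun e : ↥E => (⟨(e.1.1 ∘ Equiv.swap i j, Equiv.swap i j e.1.2), hE e.1 e.2⟩ : ↥E)) (fun e =>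
        Subtype.ext (reflEdge_reflEdge i j e.1)) with hπ
  have heq : (fun v : ↥E → G => (fun e : ↥E => v ⟨((e.1).1 ∘ Equiv.swap i j, Equiv.swap i j
      (e.1).2), hE e.1 e.2⟩)) = ⇑(MeasurableEquiv.arrowCongr' π (MeasurableEquiv.refl G)) := by
    funext v e
    rfl
  rw [heq]
  exact measurePreserving_arrowCongr' (fun _ => haarProbability G) (fun _ => haarProbability G) π
    (MeasurableEquiv.refl G) fun _ => MeasurePreserving.id _

end Transfer

end SwapRP

/-- **Registered sub-goal `SwapReflectionPositivityConeData`** (part 3/4 of stub `SwapReflectionPositivity`):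
`ℤ⁴`-integrals against `dg_∞` of measurable functions of the links in a finite set `E` are integrals
over the finite product Haar measure on `G^E` (configurations extended by `1` off `E`). [folklore] -/
theorem SwapReflectionPositivityConeData : ∀ {G : Type*} [Group G] [TopologicalSpace G] [IsTopologicalGroup G] [CompactSpace G] [MeasurableSpace G] [BorelSpace G] (E : Finset (Literature.Probability.LatticeModels.Site 4 × Fin 4)) (H : Literature.MathematicalPhysics.QuantumFieldTheory.ZdGaugeConfig 4 G → ℂ), Measurable H → DependsOn H (E : Set (Literature.Probability.LatticeModels.Site 4 × Fin 4)) → MeasureTheory.integral (Literature.MathematicalPhysics.QuantumFieldTheory.zdHaar 4 G) H = MeasureTheory.integral (MeasureTheory.Measure.pi fun _ : ↥E => Literature.MathematicalPhysics.QuantumFieldTheory.haarProbability G) (fun v => H (fun e => if h : e ∈ E then v ⟨e, h⟩ else 1)) := by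
  intro G _ _ _ _ _ _ E H hHm hdep
  exact SwapRP.integral_zdHaar_eq_integral_pi H hHm hdep

end Summit.QuantumFields.YangMills.Theorems.CurvatureKernel

end
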